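import Summits.BirchSwinnertonDyer.BirchSwinnertonDyer.Theorems.CumulativeHeegnerLeopoldtCumulativeHeegnerInclusionAtThreeLayerControl
import Summits.BirchSwinnertonDyer.Rank1Residual.X11b.AnticyclotomicSelmer
import Literature.NumberTheory.EllipticCurves.GreenbergVatsal2000.GreenbergSelmerGroups
import Literature.NumberTheory.EllipticCurves.ZpExtensionSubgroupH1LayerExhaustionProofs
import Literature.NumberTheory.EllipticCurves.SubgroupSelmerCocycleCriteriaProofs
import Literature.NumberTheory.EllipticCurves.ZpExtensionUnramifiedProofs
import Literature.NumberTheory.GaloisRepresentations.DecompositionGroupOfCompletion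
import Summits.BirchSwinnertonDyer.BirchSwinnertonDyer.Theorems.ResidualThetaTransportAtTwoResidualSignedLambdaLowerCMAtTwoCofreeSelmerTransfer
import HarnessLib

/-!
# Route UniversalToricDescent — LAYER CONTROL for the residual anticyclotomic Selmer group: `R_𝔭^Σ(K_∞, M)` is the union of
# the restrictions of the layer groups `R_𝔭^Σ(K_n, M)`, so a uniform bound on the layers bounds `R_𝔭^Σ(K_∞, M)`
# (brick 5 of the port stub `stub_residualLinkMult`, line `beta-road` v5 on crux `TwinAlgMuZeroAtThree`, stmt-BirchSwinnertonDyer-24737)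

Lead prover bsd-wall-utd-p1 g23 (`--supports stmt-BirchSwinnertonDyer-24737`). `Γ_K`-world only (no Poitou–Tate, no layer FIELDS): for a
number field `K`, a `ℤ_p`-extension `κ` (`ker κ = Gal(K̄/K_∞)`, `κ.layerSubgroup n = Gal(K̄/K_n)`), a finite discrete `p`-primary
`Γ_K`-module `M` with open stabilisers (intended: `E′[3]`), a place `𝔭 ∋ p` (intended: the STRICT prime `𝔭′`) and a set `Σ` of places,
let `R(H) := GreenbergVatsal2000.datumStrictSelmer H M p (AcSelmer.bdpData M p 𝔭) Σ ⊆ H¹(H, M)` (unramified at the finite `v ∉ Σ`,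
`v ∤ p`; Castella's strict condition at `𝔭`; no condition at the other places above `p`; every condition imposed on all conjugates).

* §1 `resOfLe_mem_unramifiedKer_iff_of_inertia_le` — for `H′ ≤ H` both containing the inertia group `I_v`, a class of `H¹(H, M)` is
  unramified at `v` over `K̄^{H′}` after restriction iff it is unramified over `K̄^H` (same inertia group; cocycle criterion).
* §2 **`resOfLe_layer_mem_residual_iff`** — under (H0) «no non-zero point of `M` is fixed by `D_𝔭 ⊓ ker κ`»: for `c ∈ H¹(K_n, M)`,
  `res_{K_n→K_∞} c ∈ R(ker κ) ↔ c ∈ R(Γ_{K_n})` (`ℤ_p`-extensions are unramified outside `p`: `ZpExtension.inertia_le_kerSubgroup_holds`; `conj_σ ∘ res = res ∘ conj_σ`: tree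
  `ThetaTransport.CofreeSelmerTransfer.conjH1_resOfLe`;
  the strict condition descends: `…CumulativeHeegnerInclusionAtThreeLayerControl.resOfLe_layer_mem_strictKer_iff`).
* §3 **`exists_forall_le_mem_image_residual`** — every `r ∈ R(ker κ)` lies in `res(R(Γ_{K_n}))` for all large `n` (layer exhaustion
  `ZpExtension.exists_mem_range_resOfLe_of_le` + §2); **`residual_finite_of_forall_ncard_layer_le`** — if every `R(Γ_{K_n})` is finite
  with at most `B` elements then `R(ker κ)` is finite with at most `B` elements.

THEOREMS ONLY (no definition, no named fact, no `sorry`). BSD is not advanced by this file.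
References: [GreenbergLNM1716] §3 Lemmas 3.1–3.3 (control along the layers); [GreenbergVatsal2000] §2 pp. 16–17, 20 (the residual Selmer
group and its local conditions); [SerreGaloisCohomology1997] I.§2.2 Prop. 8, I.§2.6; [Washington1997] Prop. 13.2.
-/

set_option linter.dupNamespace false
set_option autoImplicit false

noncomputable section

open scoped Classical

namespace Summit.BirchSwinnertonDyer.BirchSwinnertonDyer.Theorems.UniversalToricDescentResidualLayerControl

open NumberField IsDedekindDomain Field
open Literature.NumberTheory.EllipticCurves Literature.NumberTheory.EllipticCurves.GreenbergSelmer
  Literature.NumberTheory.EllipticCurves.GreenbergVatsal2000 Literature.NumberTheory.GaloisRepresentations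
open Summit.BirchSwinnertonDyer.Rank1Residual.X11b
open Summit.BirchSwinnertonDyer.BirchSwinnertonDyer.Theorems.CumulativeHeegnerInclusionAtThreeLayerControl

universe u

variable {K : Type u} [Field K] [NumberField K] {p : ℕ} [Fact p.Prime] (κ : ZpExtension K p)
variable {M : Type u} [AddCommGroup M] [DistribMulAction (absoluteGaloisGroup K) M]
  [TopologicalSpace M] [DiscreteTopology M]

/-! ## §1 The unramified condition along a restriction with the same inertia group -/

omit [Fact p.Prime] in
/-- **Same inertia group ⟹ same unramified condition.** For `H′ ≤ H ≤ Γ_K` with `I_v ≤ H′` (so `H′ ⊓ I_v = H ⊓ I_v = I_v`), a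
class `c ∈ H¹(H, M)` restricts into `unramifiedKer H′ M v` iff `c ∈ unramifiedKer H M v` (cocycle criterion: both say that a
cocycle of `c` is principal on `I_v`). [cite: GreenbergVatsal2000, §2 p. 17] [cite: SerreGaloisCohomology1997, I.§2.5] -/
theorem resOfLe_mem_unramifiedKer_iff_of_inertia_le {H H' : Subgroup (absoluteGaloisGroup K)} (hle : H' ≤ H)
    {v : HeightOneSpectrum (𝓞 K)} (hI : (adicCompletionPrime K v).inertia (absoluteGaloisGroup K) ≤ H')
    (c : subgroupH1 H M) :
    resOfLe M hle c ∈ unramifiedKer H' M v ↔ c ∈ unramifiedKer H M v := by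
  obtain ⟨φ, rfl⟩ := oneCocycleClass_surjective _ c
  have hres : resOfLe M hle (oneCocycleClass _ φ) = oneCocycleClass _
      (contOneCocycles.pullback (subgroupInclusion hle)
        (resHomOfEquivariant (subgroupInclusion hle) (AddMonoidHom.id M) (fun _ _ ↦ rfl)) φ) :=
    map_oneCocycleClass _ _ _ φ
  -- membership of an inertia element in the two `inertiaIn`
  have hmemI : ∀ x : absoluteGaloisGroup K, x ∈ inertia v → x ∈ H' := fun x hx ↦ by
    refine hI ?_
    rw [inertia_adicCompletionPrime_eq_map_absInertia]
    exact hx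
  rw [hres, GreenbergVatsal2000.unramifiedKer, GreenbergVatsal2000.unramifiedKer, AddMonoidHom.mem_ker,
    AddMonoidHom.mem_ker,
    CocycleCriteria.resH1Hom_oneCocycleClass_eq_zero_iff, CocycleCriteria.resH1Hom_oneCocycleClass_eq_zero_iff]
  constructor
  · rintro ⟨n, hn⟩
    refine ⟨n, fun x ↦ ?_⟩
    have hx := (mem_inertiaIn_iff H v x).1 x.2
    let x' : inertiaIn H' v := ⟨x.1, (mem_inertiaIn_iff H' v _).2 ⟨hmemI _ hx.2, hx.2⟩⟩
    have key := hn x'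
    exact key
  · rintro ⟨n, hn⟩
    refine ⟨n, fun x' ↦ ?_⟩
    have hx' := (mem_inertiaIn_iff H' v x').1 x'.2
    let x : inertiaIn H v := ⟨x'.1, (mem_inertiaIn_iff H v _).2 ⟨hle hx'.1, hx'.2⟩⟩
    have key := hn x
    exact key

/-! ## §2 Layer `n` ↔ `K_∞` for the residual group -/

/-- **Layer control for the residual Selmer group, class by class.** Under (H0) at `𝔭` («no non-zero point of `M` is fixed by
`D_𝔭 ⊓ Gal(K̄/K_∞)`») and continuity of the orbit maps, a class `c ∈ H¹(K_n, M)` restricts into `R_𝔭^Σ(K_∞, M)` iff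
`c ∈ R_𝔭^Σ(K_n, M)`: the unramified conditions at `v ∤ p` see the same inertia groups (`I_v ≤ Gal(K̄/K_∞)`,
`ZpExtension.inertia_le_kerSubgroup_holds`), the strict condition at `𝔭` descends (`resOfLe_layer_mem_strictKer_iff`), the
other places above `p` carry no condition. [cite: GreenbergLNM1716, §3 Lemmas 3.1–3.3] [cite: GreenbergVatsal2000, §2 pp. 16–17, 20] -/
theorem resOfLe_layer_mem_residual_iff (n : ℕ) (𝔭 : HeightOneSpectrum (𝓞 K)) (S : Set (HeightOneSpectrum (𝓞 K)))
    (hcont : ∀ m : M, Continuous fun g : absoluteGaloisGroup K ↦ g • m)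
    (h0 : ∀ m : M, (∀ x ∈ decomp 𝔭 ⊓ κ.kerSubgroup, x • m = m) → m = 0)
    (c : subgroupH1 (κ.layerSubgroup n) M) :
    resOfLe M (κ.kerSubgroup_le_layerSubgroup n) c ∈
        datumStrictSelmer κ.kerSubgroup M p (AcSelmer.bdpData M p 𝔭) S ↔
      c ∈ datumStrictSelmer (κ.layerSubgroup n) M p (AcSelmer.bdpData M p 𝔭) S := by
  rw [mem_datumStrictSelmer_iff, mem_datumStrictSelmer_iff, mem_unramifiedOutside_iff,
    mem_unramifiedOutside_iff]
  refine and_congr (forall₃_congr fun v hvS hpv ↦ forall_congr' fun σ ↦ ?_)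
    (forall₂_congr fun v hv ↦ forall_congr' fun σ ↦ ?_)
  · rw [ThetaTransport.CofreeSelmerTransfer.conjH1_resOfLe]
    exact resOfLe_mem_unramifiedKer_iff_of_inertia_le (M := M) (κ.kerSubgroup_le_layerSubgroup n)
      (ZpExtension.inertia_le_kerSubgroup_holds K p κ hpv (adicCompletionPrime_mem_primesAbove K v)) _
  · rw [ThetaTransport.CofreeSelmerTransfer.conjH1_resOfLe]
    by_cases hv𝔭 : v = 𝔭
    · subst hv𝔭
      rw [AcSelmer.bdpData_self]
      exact resOfLe_layer_mem_strictKer_iff κ n v hcont h0 _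
    · rw [AcSelmer.bdpData_of_ne p 𝔭 hv hv𝔭, AcSelmer.strictKer_relaxedDatum_eq_top,
        AcSelmer.strictKer_relaxedDatum_eq_top]
      exact iff_of_true (AddSubgroup.mem_top _) (AddSubgroup.mem_top _)

/-! ## §3 Exhaustion by the layers and the uniform bound -/

/-- **Every class of `R_𝔭^Σ(K_∞, M)` comes from `R_𝔭^Σ(K_n, M)` for all large `n`** (layer exhaustion of `H¹(K_∞, M)` for a
discrete `p`-primary `M` with open stabilisers, then §2). [cite: GreenbergLNM1716, §3 Lemma 3.2] [cite: SerreGaloisCohomology1997, I.§2.2 Prop. 8] -/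
theorem exists_forall_le_mem_image_residual (𝔭 : HeightOneSpectrum (𝓞 K)) (S : Set (HeightOneSpectrum (𝓞 K)))
    (hstab : ∀ m : M, IsOpen (MulAction.stabilizer (absoluteGaloisGroup K) m : Set (absoluteGaloisGroup K)))
    (hprim : ∀ m : M, ∃ k : ℕ, p ^ k • m = 0)
    (hcont : ∀ m : M, Continuous fun g : absoluteGaloisGroup K ↦ g • m)
    (h0 : ∀ m : M, (∀ x ∈ decomp 𝔭 ⊓ κ.kerSubgroup, x • m = m) → m = 0)
    {r : subgroupH1 κ.kerSubgroup M} (hr : r ∈ datumStrictSelmer κ.kerSubgroup M p (AcSelmer.bdpData M p 𝔭) S) :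
    ∃ n₀ : ℕ, ∀ n : ℕ, n₀ ≤ n →
      r ∈ (resOfLe M (κ.kerSubgroup_le_layerSubgroup n)) ''
        (datumStrictSelmer (κ.layerSubgroup n) M p (AcSelmer.bdpData M p 𝔭) S : Set (subgroupH1 (κ.layerSubgroup n) M)) := by
  obtain ⟨n₀, c₀, hc₀⟩ := ZpExtension.exists_mem_range_resOfLe κ M hstab hprim r
  refine ⟨n₀, fun n hn ↦ ?_⟩
  let c : subgroupH1 (κ.layerSubgroup n) M := resOfLe M (κ.layerSubgroup_antitone hn) c₀
  have hc : resOfLe M (κ.kerSubgroup_le_layerSubgroup n) c = r := by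
    have h := congrArg (fun f ↦ f c₀)
      (resOfLe_comp_holds (M := M) (κ.kerSubgroup_le_layerSubgroup n) (κ.layerSubgroup_antitone hn))
    simp only [AddMonoidHom.coe_comp, Function.comp_apply] at h
    rw [← hc₀]
    exact h
  refine ⟨c, ?_, hc⟩
  rw [SetLike.mem_coe, ← resOfLe_layer_mem_residual_iff κ n 𝔭 S hcont h0, hc]
  exact hr

/-- **A uniform bound on the layers bounds `R_𝔭^Σ(K_∞, M)`.** If every `R_𝔭^Σ(K_n, M)` is finite with at most `B` elements then
`R_𝔭^Σ(K_∞, M)` is finite with at most `B` elements (any `B + 1` of its classes come from one common layer `K_N` by §3, and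
restriction does not increase cardinality). [cite: GreenbergLNM1716, §3 Lemmas 3.1–3.3] -/
theorem residual_finite_of_forall_ncard_layer_le (𝔭 : HeightOneSpectrum (𝓞 K)) (S : Set (HeightOneSpectrum (𝓞 K)))
    (hstab : ∀ m : M, IsOpen (MulAction.stabilizer (absoluteGaloisGroup K) m : Set (absoluteGaloisGroup K)))
    (hprim : ∀ m : M, ∃ k : ℕ, p ^ k • m = 0)
    (hcont : ∀ m : M, Continuous fun g : absoluteGaloisGroup K ↦ g • m)
    (h0 : ∀ m : M, (∀ x ∈ decomp 𝔭 ⊓ κ.kerSubgroup, x • m = m) → m = 0) (B : ℕ)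
    (hfin : ∀ n : ℕ, (datumStrictSelmer (κ.layerSubgroup n) M p (AcSelmer.bdpData M p 𝔭) S :
      Set (subgroupH1 (κ.layerSubgroup n) M)).Finite)
    (hB : ∀ n : ℕ, (datumStrictSelmer (κ.layerSubgroup n) M p (AcSelmer.bdpData M p 𝔭) S :
      Set (subgroupH1 (κ.layerSubgroup n) M)).ncard ≤ B) :
    (datumStrictSelmer κ.kerSubgroup M p (AcSelmer.bdpData M p 𝔭) S : Set (subgroupH1 κ.kerSubgroup M)).Finite ∧
      (datumStrictSelmer κ.kerSubgroup M p (AcSelmer.bdpData M p 𝔭) S : Set (subgroupH1 κ.kerSubgroup M)).ncard ≤ B := by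
  set R : Set (subgroupH1 κ.kerSubgroup M) :=
    (datumStrictSelmer κ.kerSubgroup M p (AcSelmer.bdpData M p 𝔭) S : Set (subgroupH1 κ.kerSubgroup M)) with hR
  suffices hR' : R.encard ≤ B by
    exact (Set.encard_le_coe_iff_finite_ncard_le.mp hR')
  by_contra hlt
  rw [not_le] at hlt
  have hle : ((B + 1 : ℕ) : ℕ∞) ≤ R.encard := by
    rw [Nat.cast_add, Nat.cast_one]
    exact Order.add_one_le_of_lt hlt
  obtain ⟨T, hTR, hT⟩ := Set.exists_subset_encard_eq hle
  have hTfin : T.Finite := Set.finite_of_encard_eq_coe hT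
  -- a common layer for the finitely many classes of `T`
  have hex : ∀ r : T, ∃ n₀ : ℕ, ∀ n : ℕ, n₀ ≤ n →
      (r : subgroupH1 κ.kerSubgroup M) ∈ (resOfLe M (κ.kerSubgroup_le_layerSubgroup n)) ''
        (datumStrictSelmer (κ.layerSubgroup n) M p (AcSelmer.bdpData M p 𝔭) S :
          Set (subgroupH1 (κ.layerSubgroup n) M)) :=
    fun r ↦ exists_forall_le_mem_image_residual κ 𝔭 S hstab hprim hcont h0 (hTR r.2)
  choose n₀ hn₀ using hex
  haveI : Fintype T := hTfin.fintype
  let N : ℕ := Finset.univ.sup n₀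
  have hTsub : T ⊆ (resOfLe M (κ.kerSubgroup_le_layerSubgroup N)) ''
      (datumStrictSelmer (κ.layerSubgroup N) M p (AcSelmer.bdpData M p 𝔭) S :
        Set (subgroupH1 (κ.layerSubgroup N) M)) :=
    fun r hr ↦ hn₀ ⟨r, hr⟩ N (Finset.le_sup (Finset.mem_univ _))
  have hcard : T.encard ≤ (B : ℕ∞) :=
    calc T.encard ≤ ((resOfLe M (κ.kerSubgroup_le_layerSubgroup N)) ''
          (datumStrictSelmer (κ.layerSubgroup N) M p (AcSelmer.bdpData M p 𝔭) S :
            Set (subgroupH1 (κ.layerSubgroup N) M))).encard := Set.encard_le_encard hTsub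
      _ ≤ (datumStrictSelmer (κ.layerSubgroup N) M p (AcSelmer.bdpData M p 𝔭) S :
            Set (subgroupH1 (κ.layerSubgroup N) M)).encard := Set.encard_image_le _ _
      _ = ((datumStrictSelmer (κ.layerSubgroup N) M p (AcSelmer.bdpData M p 𝔭) S :
            Set (subgroupH1 (κ.layerSubgroup N) M)).ncard : ℕ∞) := ((hfin N).cast_ncard_eq).symm
      _ ≤ (B : ℕ∞) := by exact_mod_cast hB N
  rw [hT] at hcard
  have : B + 1 ≤ B := by exact_mod_cast hcard
  omega

end Summit.BirchSwinnertonDyer.BirchSwinnertonDyer.Theorems.UniversalToricDescentResidualLayerControl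

end
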